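import Summits.BirchSwinnertonDyer.BirchSwinnertonDyer.Theorems.SmallImageMuTransferMuTransferX9CoreAlgebra
import HarnessLib

/-!
# Route ByReductionTypeAtTwo, crux `OrdKatoHalfAtTwoIso` (stmt-BirchSwinnertonDyer-19573), line
# `steinberg-fibre-at-two`: the COUNT of the core at `T`-valuation `≤ 2` (pure algebra, any prime)

Seat `cruxlead-stmt-BirchSwinnertonDyer-19573-g0` (LEAD PROVER, MODE LINE). HONEST FRAMING (cell bsd-2adic): BSD is not proved by
any of this; the crux is not proved here; theorems only; `--supports stmt-BirchSwinnertonDyer-19573 --as helper`.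

WHY (sidea-stub_port-1 STUB-IDEAS-1 @82c64e14eec0e2be, engine E1; lead's PORT-MAP (P3)). At odd `p` STEP 1 of the core
(KOLY 5.7.B, `LevelE.exists_mem_pairingCoeff_ne_zero (h2 : (2:k) ≠ 0)`) produces a joint value whose Gorenstein pairing has
`T`-valuation `≤ 1`, and the count `CoreAssembly.convCoeff_zero_one_eq_zero_of_reciprocity` kills `C_0, C_1`. At `p = 2` the
characteristic-free replacement E1 (`LevelE.exists_mem_pairingCoeff_le_two_ne_zero`, sidea-1 H1) polarises one level higher
and yields valuation `≤ 2` — so the assembly needs the count ONE COEFFICIENT FURTHER: `C_0 = C_1 = C_2 = 0` under the room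
`m + 2 + ε < J`. This file supplies exactly that, for every prime (the odd core could use it too):

* `convCoeff_two_eq` — `C_2(x, y) = e(x_0, y_2) + e(x_1, y_1) + e(x_2, y_0)`.
* `convCoeff_two_aeval_left` — `C_2(U(S) x, y) = U_0 • C_2(x, y) + U_1 • C_1(x, y) + U_2 • C_0(x, y)`.
* `convCoeff_zero_one_two_eq_zero_of_reciprocity` — reciprocity for a unit multiple with room `m + 2 + ε < J` kills
  `C_0, C_1, C_2`.

References: B. Mazur, K. Rubin, Mem. AMS 799 (2004) §1.3, Prop. 1.3.2, §4.4, §5.3 [MazurRubin2004]; the tree's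
`Theorems/SmallImageMuTransferMuTransferX9CoreAlgebra.lean` (the `C_0/C_1` versions).
-/

set_option autoImplicit false
set_option linter.dupNamespace false

noncomputable section

open Finset Polynomial
open Literature.NumberTheory.GaloisRepresentations
open Literature.NumberTheory.EllipticCurves

namespace Summit.BirchSwinnertonDyer.BirchSwinnertonDyer.Rank1Residual.CoreAssembly

variable {M M' P : Type*} [AddCommGroup M] [AddCommGroup M'] [AddCommGroup P]
  (e : M →+ M' →+ P) {J : ℕ}

/-- `C_2(x, y) = e(x_0, y_2) + e(x_1, y_1) + e(x_2, y_0)`. [cite: MazurRubin2004, §1.3 and §5.3] -/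
theorem convCoeff_two_eq (hJ : 2 < J) (x : Fin J → M) (y : Fin J → M') :
    convCoeff e J 2 x y =
      e (x ⟨0, by omega⟩) (y ⟨2, hJ⟩) + e (x ⟨1, by omega⟩) (y ⟨1, by omega⟩) +
        e (x ⟨2, hJ⟩) (y ⟨0, by omega⟩) := by
  rw [convCoeff_def, sum_range_succ, sum_range_succ, sum_range_one, Nat.sub_zero,
    show 2 - 1 = 1 from rfl, Nat.sub_self,
    coeffFun_of_lt x (by omega), coeffFun_of_lt y hJ, coeffFun_of_lt x (by omega),
    coeffFun_of_lt y (by omega), coeffFun_of_lt x hJ, coeffFun_of_lt y (by omega)]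

/-- `C_2(U(S) x, y) = U_0 • C_2(x, y) + U_1 • C_1(x, y) + U_2 • C_0(x, y)` for an integer polynomial `U` in the
shift `S`. [cite: MazurRubin2004, §1.3 and §5.3] -/
theorem convCoeff_two_aeval_left (hJ : 2 < J) (U : Polynomial ℤ) (x : Fin J → M) (y : Fin J → M') :
    convCoeff e J 2 (Polynomial.aeval (shiftEnd M J) U x) y =
      U.coeff 0 • convCoeff e J 2 x y + U.coeff 1 • convCoeff e J 1 x y +
        U.coeff 2 • convCoeff e J 0 x y := by
  have hU : Polynomial.aeval (shiftEnd M J) U x =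
      U.coeff 0 • x + shiftEnd M J (Polynomial.aeval (shiftEnd M J) U.divX x) := by
    conv_lhs => rw [← Polynomial.X_mul_divX_add U]
    rw [map_add, map_mul, Polynomial.aeval_X, Polynomial.aeval_C, LinearMap.add_apply,
      Module.End.mul_apply, Module.algebraMap_end_apply, add_comm]
  rw [hU, convCoeff_add_left, convCoeff_succ_shiftEnd_left e hJ,
    convCoeff_one_aeval_left e (by omega), Polynomial.coeff_divX, Polynomial.coeff_divX]
  have h0 : convCoeff e J 2 (U.coeff 0 • x) y = U.coeff 0 • convCoeff e J 2 x y :=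
    map_zsmul ((convCoeffHom e J 2).flip y) (U.coeff 0) x
  rw [h0]
  abel

/-- **The count at valuation `≤ 2`**: if every convolution coefficient of index `i` with `i + ε < J` of
`(U(S)·S^m k, c)` vanishes, `U(0)` is prime to `p`, `P` is `p`-torsion and `m + 2 + ε < J`, then
`C_0(k, c) = C_1(k, c) = C_2(k, c) = 0`. (The room `m + 2 + ε < J` is one more than the odd-prime count's; it is what the
characteristic-free level-`2` polarisation E1 costs.) [cite: MazurRubin2004, Prop. 1.3.2, §4.4] -/
theorem convCoeff_zero_one_two_eq_zero_of_reciprocity {p : ℕ} (hp : p.Prime) (hP : ∀ c : P, (p : ℤ) • c = 0)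
    {m ε : ℕ} (hm : m + 2 + ε < J) (U : Polynomial ℤ) (hU : ¬ ((p : ℤ) ∣ U.coeff 0))
    (k : Fin J → M) (c : Fin J → M')
    (hrec : ∀ i : ℕ, i + ε < J →
      convCoeff e J i (Polynomial.aeval (shiftEnd M J) U ((shiftEnd M J ^ m) k)) c = 0) :
    convCoeff e J 0 k c = 0 ∧ convCoeff e J 1 k c = 0 ∧ convCoeff e J 2 k c = 0 := by
  obtain ⟨hC0, hC1⟩ := convCoeff_zero_one_eq_zero_of_reciprocity e hp hP (by omega) U hU k c hrec
  refine ⟨hC0, hC1, ?_⟩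
  have hr2 := hrec (m + 2) (by omega)
  rw [aeval_shiftEnd_pow_apply, convCoeff_shiftEnd_pow_left_eq e _ (by omega), if_pos (by omega),
    show m + 2 - m = 2 by omega, convCoeff_two_aeval_left e (by omega), hC0, hC1, smul_zero, smul_zero,
    add_zero, add_zero] at hr2
  exact eq_zero_of_zsmul_eq_zero_of_not_dvd hp (hP _) hU hr2

end Summit.BirchSwinnertonDyer.BirchSwinnertonDyer.Rank1Residual.CoreAssembly

end
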